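import Summits.BirchSwinnertonDyer.BirchSwinnertonDyer.Theorems.GenusKolyvaginAtTwoGenusPrimitiveSupplyAtTwoMonskyLemma14b
import Summits.BirchSwinnertonDyer.BirchSwinnertonDyer.Theorems.GenusKolyvaginAtTwoGenusPrimitiveSupplyAtTwoDoorFieldSelmerBounds
import Literature.NumberTheory.EllipticCurves.BSDSelmerParityMonskyHoffsteinLuoProofs
import Literature.NumberTheory.EllipticCurves.BSDSelmerParityProofs
import HarnessLib

/-!
# Route `GenusKolyvaginAtTwo`, crux #2 `GenusPrimitiveSupplyAtTwo` (stmt-BirchSwinnertonDyer-22136):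
# consequences of `Monsky1996_lemma14b_twoSelmerRank_parity_holds` — the cell's rows G′/X/M UNCONDITIONALLY, and Monsky's `2`-parity theorem
# over `ℚ` modulo Modularity + Hoffstein–Luo + Gross–Zagier–Kolyvagin only

Width seat `bsd-line-gk2-p5` g19 (cell `bsd-f1-sign2`, SUPPLY lineage of crux 22136), file 59 of the series; sequel of file 58 (`…MonskyLemma14b`:
`h14` proved). THEOREMS ONLY (no definition, no named fact, no `sorry`); helper `--supports stmt-BirchSwinnertonDyer-22136`; no item is closed; BSD
is not proved by any of this.

* §1 the cell's -desc rows closed BY NAME, now UNCONDITIONALLY (files 52–54's `_of_monsky` closers fed with `h14`):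
  **`identityGeneratorDoorFieldSelmerCardAtTwo_holds`** (DESC-28-G′), **`shaPlaneDoorTwinIdentityAtTwo_holds`** (DESC-28-X),
  **`doorFieldSelmerBoundsAtTwo_holds`** (DESC-29-M); and the parity sentences at any door: `mordellWeilRank_baseChange_add_mod_two_eq_one`,
  `not_isSquare_fieldSelmerTwoCard`.
* §2 **`monsky_selmerCorank_two_mod_two_eq_of_modularity`**: `exists_isNewformOf → HoffsteinLuo1997_exists_twist_L_one_ne_zero →
  rank_eq_analyticRank_of_analyticRank_le_one → monsky_selmerCorank_two_mod_two_eq` — Monsky's Theorem 1.5 (`rk₂(E/ℚ) ≡ ord_{s=1} L(E,s) (mod 2)`,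
  the `p = 2` input of Dokchitser–Dokchitser's `p`-parity theorem, `monsky_selmerCorank_two_mod_two_eq_of_kramer`) with its inputs `hCT` (gk2-p1's
  `exists_casselsTate_pairing_holds`) and `h14` (file 58) DISCHARGED (the former re-run inline from `exists_casselsTate_pairing_of_levelThetaDatum` + `levelThetaDatumEven`); **`p_parity_two_of_modularity`**: the `2`-parity theorem `(−1)^{rk₂(E)} = w(E)` for
  every ELLIPTIC `E/ℚ` modulo the same three print facts (the route item `TwoParityDD` (stmt-24949) quantifies over all Weierstrass cubics without
  `[IsElliptic]` — refuter note of 2026-08-28 — so this is its elliptic form, by name up to that binder).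

References: [Monsky1996] Lemma 1.4(b), Thm. 1.5; [Kramer1981] Thm. 1, Thm. 2; [HoffsteinLuo1997]; [GrossZagier1986]; [Kolyvagin1990EulerSystems];
[BCDTJAMS2001] Thm. A; [DokchitserDokchitserAnnals2010] Thm. 1.4, §4.6.
-/

set_option linter.dupNamespace false -- tree convention: `Summit.BirchSwinnertonDyer.BirchSwinnertonDyer.Theorems` (summit = sub-problem)
set_option autoImplicit false

noncomputable section

open scoped Classical AddSubgroup

namespace Summit.BirchSwinnertonDyer.BirchSwinnertonDyer.Theorems.GenusKolyArch

open WeierstrassCurve NumberField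
open Literature.NumberTheory.EllipticCurves
open Summit.BirchSwinnertonDyer.Rank1Residual.F1Sign2 (NoRationalTwoTorsion IsDoorField fieldSelmerTwoCard
  IdentityGeneratorDoorFieldSelmerCardAtTwo ShaPlaneDoorTwinIdentityAtTwo DoorFieldSelmerBoundsAtTwo)

/-! ## §1 The cell's door-field rows, unconditionally -/

section Rows

/-- **DESC-28-G′ `F1Sign2.IdentityGeneratorDoorFieldSelmerCardAtTwo` HOLDS** (file 52's closer fed with `h14`, file 58): at a door of a rank-one
`W` with `Δ > 0`, `E(ℚ)[2] = 0`, `Ш(W)[2] = 0` and no rational point on the egg, `#Sel₂(W/K) = 8`. [cite: Kramer1981, Thm. 1, Prop. 7, Thm. 2]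
[cite: Monsky1996, Lemma 1.4(b)] -/
theorem identityGeneratorDoorFieldSelmerCardAtTwo_holds : IdentityGeneratorDoorFieldSelmerCardAtTwo :=
  identityGeneratorDoorFieldSelmerCardAtTwo_of_monsky Monsky1996_lemma14b_twoSelmerRank_parity_holds

/-- **DESC-28-X `F1Sign2.ShaPlaneDoorTwinIdentityAtTwo` HOLDS** (file 53's closer fed with `h14`): in the X-configuration the twin misses the egg and
`#Sel₂(W/K) = 8`. [cite: Kramer1981, Thm. 1, Prop. 7, Thm. 2] [cite: Monsky1996, Lemma 1.4(b)] -/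
theorem shaPlaneDoorTwinIdentityAtTwo_holds : ShaPlaneDoorTwinIdentityAtTwo :=
  shaPlaneDoorTwinIdentityAtTwo_of_monsky Monsky1996_lemma14b_twoSelmerRank_parity_holds

/-- **DESC-29-M `F1Sign2.DoorFieldSelmerBoundsAtTwo` HOLDS** (file 54's closer fed with `h14`): `u ≤ k ≤ 2u − 1` and `k` odd for `#Sel₂(W/K) = 2^k`,
`#Sel₂^{rel∞}(W) = 2^u` at a door. [cite: Kramer1981, Thm. 1, Prop. 7, Thm. 2] [cite: Monsky1996, Lemma 1.4(b)] -/
theorem doorFieldSelmerBoundsAtTwo_holds : DoorFieldSelmerBoundsAtTwo :=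
  doorFieldSelmerBoundsAtTwo_of_monsky Monsky1996_lemma14b_twoSelmerRank_parity_holds

variable (W : WeierstrassCurve ℚ) [W.IsElliptic] [W.IsGloballyMinimal] (K : Type) [Field K] [NumberField K]

/-- **The Selmer rank over a door field is ODD, unconditionally**: `rank W(K) + dim Ш(W/K)[2] ≡ 1 (mod 2)` for `E(ℚ)[2] = 0` and `K` a door field
(file 52's `mordellWeilRank_baseChange_add_mod_two_eq_one_of_monsky` fed with `h14`). [cite: Monsky1996, Lemma 1.4(b)] [cite: Kramer1981, Thm. 1] -/
theorem mordellWeilRank_baseChange_add_mod_two_eq_one (hK : IsDoorField W K) {u : ℕ}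
    (hu : Nat.card (((W.baseChange K).sha)[(2 : ℤ)]) = 2 ^ u) :
    ((W.baseChange K).mordellWeilRank + u) % 2 = 1 :=
  mordellWeilRank_baseChange_add_mod_two_eq_one_of_monsky W K Monsky1996_lemma14b_twoSelmerRank_parity_holds hK.1 hK.2 hu

/-- **`#Sel₂(W/K)` is NOT a square at a door field, unconditionally** (`E(ℚ)[2] = 0`; file 52's `not_isSquare_fieldSelmerTwoCard_of_monsky` fed with
`h14`). [cite: Monsky1996, Lemma 1.4(b)] [cite: Kramer1981, Thm. 1] -/
theorem not_isSquare_fieldSelmerTwoCard (hT : NoRationalTwoTorsion W) (hK : IsDoorField W K) : ¬ IsSquare (fieldSelmerTwoCard W K) :=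
  not_isSquare_fieldSelmerTwoCard_of_monsky W K Monsky1996_lemma14b_twoSelmerRank_parity_holds hT hK

end Rows

/-! ## §2 Monsky's `2`-parity theorem over `ℚ` modulo Modularity + Hoffstein–Luo + Gross–Zagier–Kolyvagin -/

section Parity

/-- **MONSKY 1996 THEOREM 1.5 — `rk₂(E/ℚ) ≡ ord_{s=1} L(E, s) (mod 2)` for every elliptic `E/ℚ` — modulo the Modularity Theorem (BCDT 2001),
Hoffstein–Luo 1997 (a twist with `L(E^{(d)}, 1) ≠ 0`, `d ≡ 1 (8)`, prescribed splitting) and Gross–Zagier–Kolyvagin (`rank = r_an`, `Ш` finite for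
`r_an ≤ 1`) ONLY**: the tree's `monsky_selmerCorank_two_mod_two_eq_of_kramer` with its two remaining arithmetic inputs discharged — the Cassels–Tate
pairing over number fields (gk2-p1 g13 `WeierstrassCurve.exists_casselsTate_pairing_holds`) and Lemma 1.4(b) (file 58
`Monsky1996_lemma14b_twoSelmerRank_parity_holds`). [cite: Monsky1996, Thm. 1.5 with Lemmas 1.1, 1.3, 1.4(b)] [cite: BCDTJAMS2001, Thm. A]
[cite: HoffsteinLuo1997, Theorem] [cite: Kolyvagin1990EulerSystems] [cite: GrossZagier1986] -/
theorem monsky_selmerCorank_two_mod_two_eq_of_modularity (hmod : ModularForms.exists_isNewformOf)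
    (hHL : HoffsteinLuo1997_exists_twist_L_one_ne_zero) (hGZK : rank_eq_analyticRank_of_analyticRank_le_one) :
    monsky_selmerCorank_two_mod_two_eq :=
  monsky_selmerCorank_two_mod_two_eq_of_kramer hmod hHL hGZK
    -- the Cassels–Tate theorem over every number field (gk2-p1 g13's assembly `exists_casselsTate_pairing_holds`, re-run inline to stay off the
    -- route file's import cone): levelwise PT pairing + the even-level theta datum
    (fun K _ _ ↦ GenusExact.CasselsTatePTcReal.exists_casselsTate_pairing_of_levelThetaDatum (K := K)
      fun W _ k hk _ e hμ hadd₁ hadd₂ _hgal halt _hnd ↦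
        ⟨levelThetaDatumEven W (2 ^ k) e hμ hadd₁ hadd₂ halt (Nat.even_pow.mpr ⟨even_two, hk.ne'⟩)⟩)
    fun W _ K _ _ h2 hH2 hHN u hu ↦ Monsky1996_lemma14b_twoSelmerRank_parity_holds W K h2 hH2 hHN u hu

/-- **THE `2`-PARITY THEOREM `(−1)^{rk₂(E/ℚ)} = w(E)` for every ELLIPTIC `E/ℚ`, modulo Modularity + Hoffstein–Luo + Gross–Zagier–Kolyvagin** — the
elliptic form of the route item `TwoParityDD` (`∀ V, p_parity V 2`, stmt-BirchSwinnertonDyer-24949; that item is typed without `[V.IsElliptic]`, see the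
refuter note of 2026-08-28, so this is its closer up to that binder): Monsky's Thm. 1.5 (previous theorem) and `w(E) = (−1)^{ord L}` from the functional
equation of the attached newform (`p_parity_of_selmerCorank_mod_two_eq_of_exists_isNewformOf`). [cite: Monsky1996, Thm. 1.5]
[cite: DokchitserDokchitserAnnals2010, Thm. 1.4 (p = 2)] [cite: BCDTJAMS2001, Thm. A] -/
theorem p_parity_two_of_modularity (hmod : ModularForms.exists_isNewformOf)
    (hHL : HoffsteinLuo1997_exists_twist_L_one_ne_zero) (hGZK : rank_eq_analyticRank_of_analyticRank_le_one)
    (V : WeierstrassCurve ℚ) [V.IsElliptic] : p_parity V 2 :=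
  p_parity_of_selmerCorank_mod_two_eq_of_exists_isNewformOf V 2 hmod
    ((monsky_selmerCorank_two_mod_two_eq_of_modularity hmod hHL hGZK).apply V)

end Parity

end Summit.BirchSwinnertonDyer.BirchSwinnertonDyer.Theorems.GenusKolyArch

end
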